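import Literature.IUT.HodgeTheaters.Cor53iArithDivThroughAutOfCor411
import Literature.AlgebraicGeometry.Frobenioids.Cor411ModelFrobenioid
import Literature.AnabelianGeometry.EtaleTheta.Discharge.Sec3TemperedFrobenioidRigidOverBaseOfDataRigidRatio
import HarnessLib

/-!
# [EtTh] Def. 3.6 tempered Frobenioids: a self-equivalence over the identity of the base moves zero divisors through a
# NATURAL AUTOMORPHISM of the divisor monoid `Φ` over `𝟭_D` — [FrdI] Cor. 4.11 (iv) at the model, the Φ-half of the
# extraction Prop `SelfEquivInducesDataAutRatio` (★ p530466) DISCHARGED modulo the [FrdI] standing hypotheses BY NAME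

S. Mochizuki, *The geometry of Frobenioids I*, Kyushu J. Math. **62** (2008), Cor. 4.11 (ii)/(iv) pp. 91–92 (the `1`-unique base
equivalence `Ψ^Base` with rigid composites; the divisor-monoid isomorphism `Ψ^Φ` over `Ψ^Base` with `Div(Ψ φ) = η_A^* Ψ^Φ(Div φ)`)
[cite: MochizukiFrdI2008, Cor. 4.11 p.91] — AS PROVED in the tree at THE model Frobenioid by abc-iut-L1-t14
(`ModelFrobenioid.exists_cor411iv_data_model`, `Cor411ModelFrobenioid.lean`); Thm. 4.9 p. 88 («category-theoreticity of divisor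
monoids»); S. Mochizuki, *The étale theta function …*, Def. 3.6 p. 77 [cite: MochizukiEtTh2009, Def 3.6 p.77] (the tempered Frobenioid
IS a model Frobenioid — abc-iut-L2-t3 `TemperedFrobenioid.category`).  Consumer locus: [IUTchI] Cor. 5.3 (iv) p. 144–145
([IUTchI] Cor 5.3 (iv) p.144) [claim: Mochizuki2012, status: disputed] (nothing of the series asserted; no side taken on [IUTchIII] Cor. 3.12).

PROOF-ONLY companion (cell abc-iut; author abc-iut-L5-t1 gen 13, offer (α) «HIND-RATIO-DISCHARGE@MODEL», Φ-HALF; sizing memo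
HOME/staging/L5/L5-t1/g13/HIND-RATIO-DISCHARGE-SIZING.md).  The displayed extraction Prop of the (iv) telescope,
`TemperedFrobenioid.SelfEquivInducesDataAutRatio C` (★ p530466), asks for a data automorphism `(a, b)` and `η` with (Φ) `Div(Ψ φ) = η^* a(Div φ)`
and (B) the ratio formula on birational units.  THIS FILE proves the (Φ)-clause outright, as the tempered twin of abc-iut-L5-t11's
★ `GlobalDivisorData.arith_exists_divAut_of_overBase` (R81, at the arithmetic model):

* **`TemperedFrobenioid.exists_divisorAut_of_overBase`** — for every self-equivalence `Ψ` of `C.category` with `Ψ ⋙ Base ≅ Base` there are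
  a divisor-monoid isomorphism `θ` over THE IDENTITY of `D` (a natural automorphism of `Φ`: components `θ.iso A : Φ(A) ≃* Φ(A)`, natural in
  `A` — `θ.natural`) and a base identification `η'` with `Div(Ψ φ) = η'_X^* θ_{X.base}(Div φ)` for every arrow `φ`.  PROOF: Cor. 4.11 (iv)
  data `(ΨBase, Ψ^Φ, η)` at the model; the `1`-uniqueness of the base square gives `ε : 𝟭 ≅ ΨBase`; `θ := ε^* ∘ Ψ^Φ` (t11's generic
  `DivisorMonoidIsoOverBase.exists_transport_along_iso`), `η' := η · Base(ε⁻¹)`.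

BINDERS (all [FrdI], BY NAME, displayed): Thm 5.2 `Hypotheses`, `Φ` perf-factorial, `D` slim and FSMFF, `Φ` non-dilating and non-zero — the
six of abc-iut-L5-t4's (iv) files — PLUS the Def 4.5 (ii) RATIONALITY binder `hrat₁` of Cor. 4.11 (iii)/(iv) at THE birationalization
(`PreFrobenioidData.IsRational … PrimarySupp`; at a concrete `(Φ, B, Div_B)` it is `ModelFrobenioid.isRational_biratData_of_exists_divB`).
The B-half (natural `b` with the ratio formula — Cor. 4.10 / Thm 5.2 (ii)) is NOT here.  No definitions, no instances; typed ≠ proved for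
`SelfEquivInducesDataAutRatio` as a whole; nothing here asserts abc proved or refuted.
-/

noncomputable section

set_option backward.isDefEq.respectTransparency false

namespace Literature.AnabelianGeometry.EtaleTheta

open CategoryTheory Opposite Literature.AlgebraicGeometry.Frobenioids Literature.IUT.HodgeTheaters
open Literature.AlgebraicGeometry.Frobenioids.PreFrobenioid Literature.AlgebraicGeometry.Frobenioids.PreFrobenioidData

namespace TemperedFrobenioid

universe u₀ v₀ u v w

variable {D₀ : Type u₀} [Category.{v₀} D₀] {V : FrdIMonoidStub.{w}}
  {T : RealifiedDivisorMonoids (D₀ := D₀) V} {D : Type u} [Category.{v} D]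
  {VD : FrdICatStub.{u, v, w} D} (C : TemperedFrobenioid T D VD)

/-- **[FrdI] Cor 4.11 (iv) for a self-equivalence OVER THE IDENTITY of the base of an [EtTh] Def 3.6 tempered Frobenioid: zero divisors move
through a NATURAL AUTOMORPHISM `θ` of the divisor monoid `Φ` over `𝟭_D` and a base identification `η'`** — for every `Ψ : C.category ≌ C.category`
with `Ψ ⋙ Base ≅ Base` there are `θ : DivisorMonoidIsoOverBase S S (𝟭 D)` (`S` = the model data of `(Φ, B, Div_B)`) and `η' : Ψ ⋙ Base ≅ Base` with
`Div(Ψ φ) = η'_X^* θ_{X.base}(Div φ)` for all `φ : X → Y`.  This is the (Φ)-clause of `SelfEquivInducesDataAutRatio C` (★ p530466) with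
`a := θ.iso`, modulo the six standing [FrdI] hypotheses and the Def 4.5 (ii) rationality binder `hrat₁`, all BY NAME.  PROOF: abc-iut-L1-t14's
`ModelFrobenioid.exists_cor411iv_data_model` (data `(ΨBase, Ψ^Φ, η)`), the `1`-uniqueness of the base square (`ε : 𝟭 ≅ ΨBase`), abc-iut-L5-t11's
`DivisorMonoidIsoOverBase.exists_transport_along_iso` (`θ := ε^* ∘ Ψ^Φ`), `η' := η · Base(ε⁻¹)`.
[cite: MochizukiFrdI2008, Cor. 4.11 (iv) p.92] [claim: Mochizuki2012, status: disputed] -/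
theorem exists_divisorAut_of_overBase
    (h : ModelFrobenioid.Hypotheses C.divisorMonoid C.ratFnFunctor)
    (hpf : Objectwise (fun M _ => IsPerfFactorial M) C.divisorMonoid) (hsl : IsSlim D) (hfs : IsOfFSMFFType D)
    (hnd : IsNonDilatingOn C.divisorMonoid) (hz : ¬ ModelFrobenioid.IsZeroMonoid C.divisorMonoid)
    (hrat₁ : ∀ A : C.category, PreFrobenioidData.IsRational
      (biratData (h.isFrobenioid C.divisorMonoid C.ratFnFunctor C.divBNatTrans)
        (hasBiratSquares_of_isFrobenioid (h.isFrobenioid C.divisorMonoid C.ratFnFunctor C.divBNatTrans)))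
      (S := ModelFrobenioid.data C.divisorMonoid C.ratFnFunctor C.divBNatTrans) (fun a 𝔭 => PrimarySupp a 𝔭) A)
    (Ψ : C.category ≌ C.category) (hΨ : Nonempty (Ψ.functor ⋙ C.baseFunctorOfCategory ≅ C.baseFunctorOfCategory)) :
    ∃ (θ : (ModelFrobenioid.data C.divisorMonoid C.ratFnFunctor C.divBNatTrans).DivisorMonoidIsoOverBase
        (ModelFrobenioid.data C.divisorMonoid C.ratFnFunctor C.divBNatTrans) (𝟭 D))
      (η' : Ψ.functor ⋙ C.baseFunctorOfCategory ≅ C.baseFunctorOfCategory),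
      ∀ ⦃A B : C.category⦄ (φ : A ⟶ B),
        ModelFrobenioid.div (Ψ.functor.map φ) =
          pull C.divisorMonoid (η'.hom.app A) (θ.iso A.base (ModelFrobenioid.div φ)) := by
  obtain ⟨ΨBase, E', η, hsq, -, hdivE, -, -, -⟩ :=
    ModelFrobenioid.exists_cor411iv_data_model (DivB₁ := C.divBNatTrans) (DivB₂ := C.divBNatTrans)
      h h hpf hpf hsl hsl hfs hfs hnd hnd hz hz hrat₁ Ψ
  obtain ⟨i⟩ := hΨ
  -- the `1`-uniqueness of the base square: `ΨBase ≅ 𝟭`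
  have i' : Ψ.functor ⋙ (ModelFrobenioid.data C.divisorMonoid C.ratFnFunctor C.divBNatTrans).base ≅
      (ModelFrobenioid.data C.divisorMonoid C.ratFnFunctor C.divBNatTrans).base ⋙ 𝟭 D :=
    i ≪≫ (Functor.rightUnitor _).symm
  obtain ⟨ε⟩ := hsq.2.2 (𝟭 _) ⟨i'⟩
  obtain ⟨θ, hθ⟩ := PreFrobenioidData.DivisorMonoidIsoOverBase.exists_transport_along_iso _ E' ε
  -- the base identification `η' := η · Base(ε⁻¹)`
  let η' : Ψ.functor ⋙ C.baseFunctorOfCategory ≅ C.baseFunctorOfCategory :=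
    η ≪≫ Functor.isoWhiskerLeft (ModelFrobenioid.data C.divisorMonoid C.ratFnFunctor C.divBNatTrans).base ε.symm ≪≫
      Functor.rightUnitor _
  refine ⟨θ, η', fun A B φ => ?_⟩
  change (ModelFrobenioid.data C.divisorMonoid C.ratFnFunctor C.divBNatTrans).div (Ψ.functor.map φ) =
    (ModelFrobenioid.data C.divisorMonoid C.ratFnFunctor C.divBNatTrans).pull (η'.hom.app A)
      (θ.iso A.base ((ModelFrobenioid.data C.divisorMonoid C.ratFnFunctor C.divBNatTrans).div φ))
  have hd := hdivE φ
  change _ = (ModelFrobenioid.data C.divisorMonoid C.ratFnFunctor C.divBNatTrans).pull (η.hom.app A)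
    (E'.iso A.base ((ModelFrobenioid.data C.divisorMonoid C.ratFnFunctor C.divBNatTrans).div φ)) at hd
  rw [hd, hθ]
  simp only [η', Iso.trans_hom, NatTrans.comp_app, Functor.isoWhiskerLeft_hom, Functor.whiskerLeft_app, Iso.symm_hom,
    Functor.rightUnitor_hom_app]
  erw [Category.comp_id]
  rw [(ModelFrobenioid.data C.divisorMonoid C.ratFnFunctor C.divBNatTrans).pull_comp]
  congr 1
  change _ = (ModelFrobenioid.data C.divisorMonoid C.ratFnFunctor C.divBNatTrans).pull (ε.inv.app A.base)
      ((ModelFrobenioid.data C.divisorMonoid C.ratFnFunctor C.divBNatTrans).pull (ε.hom.app A.base) (E'.iso A.base _))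
  rw [← (ModelFrobenioid.data C.divisorMonoid C.ratFnFunctor C.divBNatTrans).pull_comp, ε.inv_hom_id_app,
    (ModelFrobenioid.data C.divisorMonoid C.ratFnFunctor C.divBNatTrans).pull_id]

end TemperedFrobenioid

end Literature.AnabelianGeometry.EtaleTheta

end
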